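/-
Copyright (c) 2026. All rights reserved.
Released under Apache 2.0 license as described in the file LICENSE.
Authors: abc-iut cell, seat abc-iut-w5-d144 (gen 5; row «H1PRIME-ELLIPTIC-MULTI», part 1: automorphisms
of an elliptic curve minus a finite set extend to affine automorphisms of the curve).
-/
import Literature.AnabelianGeometry.AbsoluteAnabelian.ArchimedeanHolFieldFunctorGeometricOverIdRigidTorus
import Literature.AnabelianGeometry.AbsoluteAnabelian.HolomorphicEllipticCuspidalizationFiniteEtaleRigidity
import Literature.AlgebraicTopology.FundamentalGroup.FreeGroupPuncturedPlane
import Literature.Geometry.Kaehler.ComplexTorusMapsHomotopyClassification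
import HarnessLib

/-!
# Automorphisms of `E ∖ S` extend to affine maps of the elliptic curve `E` (PROOF-ONLY)

Topic `Literature/AnabelianGeometry/AbsoluteAnabelian`; geometric column of S. Mochizuki, *Topics in
absolute anabelian geometry III*, proof of Prop 4.2 (i) p.106 (Lemma 4.3's input «`Aut(X) → Out(Π_X)`
injective» at the curves of type `(1, r)`), part 1 of the abc-iut cell's row «H1PRIME-ELLIPTIC-MULTI».
Classical content (Farkas–Kra, *Riemann Surfaces* IV.6, V.4: an automorphism of a compact Riemann surface
minus finitely many points extends over the punctures by Riemann's removable singularity theorem; on a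
complex torus a holomorphic self-map is affine, Lange–Birkenhake Prop. 1.1.6):

* `HolRS.exists_continuous_extension_of_homeomorph_compl_finite` — **topological extension**: for a
  compact Hausdorff `T`, a finite `S ⊆ T` every point of which has arbitrarily small CONNECTED punctured
  neighbourhoods missing `S`, and a self-homeomorphism `h` of `T ∖ S`, there is a continuous `H : T → T`
  with `H = h` on `T ∖ S` and `H(S) ⊆ S` (`h` is proper, so `h(x) → S` as `x → s ∈ S`; by connectedness
  `h(x)` stays near ONE point of `S`).
* `HolRS.exists_small_punctured_nhd_complexTorus` — the hypothesis for the complex torus `ℂ/Φ(ℤ²)`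
  (images of punctured discs under the covering map).
* ★ `HolRS.exists_affine_extension_of_iso_compl_finite` — **every automorphism `σ` (in `HolRS`) of the
  curve `ℂ/Φ(ℤ²) ∖ S` of type `(1, |S|)` is the restriction of a holomorphic AFFINE map
  `H = ρ(M) + H 0` of the torus with `H(S) ⊆ S`** (continuous extension + removable singularities,
  `RiemannSurface.mdifferentiableAt_of_continuousAt`, + `ComplexTorus.eq_mapMatrix_topRep_add_of_mdifferentiable`).

Everything is a theorem; no definition, no instance, no named fact.  Classical; MODEL ≠ reconstruction;
nothing here bears on the disputed [IUTchIII] Cor. 3.12.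

## References

* S. Mochizuki, *Topics in Absolute Anabelian Geometry III* (2015), Prop. 4.2 (i) proof, Lemma 4.3 p.106.
  [MochizukiAbsTopIII2015]
* H. M. Farkas, I. Kra, *Riemann Surfaces*, 2nd ed. (1992), IV.6, V.4. [FarkasKra1992]
* H. Lange, Ch. Birkenhake, *Complex Abelian Varieties* (1992), Prop. 1.1.6. [LangeBirkenhake1992]
-/

set_option autoImplicit false

noncomputable section

namespace Literature.AnabelianGeometry.AbsoluteAnabelian

namespace HolRS

open scoped _root_.Manifold _root_.ContDiff _root_.Topology
open _root_.Function _root_.Set _root_.Filter _root_.CategoryTheory _root_.TopologicalSpace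
open Literature.Geometry.Kaehler Literature.Geometry.Kaehler.ComplexTorus
open Literature.AlgebraicTopology.FundamentalGroup

/-! ### §1 Topological extension of a self-homeomorphism of `T ∖ S` across a finite `S` -/

section Topological

variable {T : Type*} [TopologicalSpace T] [T2Space T] [CompactSpace T] {S : Set T}

/-- **A self-homeomorphism of `T ∖ S` pushes points near `s ∈ S` towards `S`**: for `h : T ∖ S ≃ₜ T ∖ S`
and an open `U ⊇ S`, `h x ∈ U` for `x` near `s` (`T` compact: `T ∖ U` is compact, so is its preimage
under the homeomorphism, whose image in `T` is closed and misses `s`).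
[cite: FarkasKra1992, IV.6 (method; properness)] -/
theorem eventually_mem_of_homeomorph_compl (h : ↥(Sᶜ) ≃ₜ ↥(Sᶜ)) {s : T} (hs : s ∈ S) {U : Set T}
    (hU : IsOpen U) (hSU : S ⊆ U) :
    ∀ᶠ x in comap (Subtype.val : ↥(Sᶜ) → T) (𝓝 s), ((h x : ↥(Sᶜ)) : T) ∈ U := by
  -- `K = T ∖ U`, read inside `T ∖ S`, is compact
  set KX : Set ↥(Sᶜ) := Subtype.val ⁻¹' Uᶜ with hKX
  have hKXc : IsCompact KX := by
    rw [Topology.IsEmbedding.subtypeVal.isCompact_iff]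
    have : Subtype.val '' KX = Uᶜ := by
      rw [hKX, Set.image_preimage_eq_inter_range, Subtype.range_coe]
      exact Set.inter_eq_left.2 fun y hy hyS => hy (hSU hyS)
    rw [this]
    exact hU.isClosed_compl.isCompact
  have hC : IsCompact (Subtype.val '' (h ⁻¹' KX) : Set T) :=
    ((h.isCompact_preimage).2 hKXc).image continuous_subtype_val
  have hsC : s ∉ (Subtype.val '' (h ⁻¹' KX) : Set T) := by
    rintro ⟨x, -, hx⟩
    exact x.2 (hx ▸ hs)
  filter_upwards [preimage_mem_comap (hC.isClosed.isOpen_compl.mem_nhds hsC)] with x hx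
  by_contra hxU
  exact hx ⟨x, hxU, rfl⟩

/-- **Topological extension across finitely many punctures.**  Let `T` be compact Hausdorff, `S ⊆ T`
finite, and suppose every `s ∈ S` has, inside every neighbourhood, a non-empty preconnected set `P`
missing `S` with `P ∪ {s}` a neighbourhood of `s` (small punctured discs).  Then every self-homeomorphism
`h` of `T ∖ S` is the restriction of a continuous `H : T → T` with `H(S) ⊆ S`: near `s`, `h` takes values
in a small neighbourhood of `S` (`eventually_mem_of_homeomorph_compl`), and the connected punctured
neighbourhood is carried into the neighbourhood of a SINGLE point `s' =: H s`.
[cite: FarkasKra1992, IV.6 (method)] -/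
theorem exists_continuous_extension_of_homeomorph_compl_finite (hS : S.Finite)
    (hP : ∀ s ∈ S, ∀ W ∈ 𝓝 s, ∃ P ⊆ W, IsPreconnected P ∧ P.Nonempty ∧ P ⊆ Sᶜ ∧ insert s P ∈ 𝓝 s)
    (h : ↥(Sᶜ) ≃ₜ ↥(Sᶜ)) :
    ∃ H : T → T, Continuous H ∧ (∀ x : ↥(Sᶜ), H x = h x) ∧ ∀ s ∈ S, H s ∈ S := by
  classical
  -- pairwise disjoint open neighbourhoods of the points of `S`
  obtain ⟨U, hU, hUd⟩ := hS.t2_separation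
  -- the limit point of `h` at each puncture
  have key : ∀ s ∈ S, ∃ s' ∈ S,
      Tendsto (fun x : ↥(Sᶜ) => ((h x : ↥(Sᶜ)) : T)) (comap Subtype.val (𝓝 s)) (𝓝 s') := by
    intro s hs
    have hU₀o : IsOpen (⋃ s' ∈ S, U s') := isOpen_biUnion fun s' _ => (hU s').2
    have hSU₀ : S ⊆ ⋃ s' ∈ S, U s' := fun s' hs' => Set.mem_biUnion hs' (hU s').1
    obtain ⟨W, hW, hWU⟩ := mem_comap.1 (eventually_mem_of_homeomorph_compl h hs hU₀o hSU₀)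
    obtain ⟨P, hPW, hPc, ⟨p₀, hp₀⟩, hPS, hPn⟩ := hP s hs W hW
    -- the image `Q` of the punctured neighbourhood `P` under `h`
    set Q : Set T := (fun x : ↥(Sᶜ) => ((h x : ↥(Sᶜ)) : T)) '' (Subtype.val ⁻¹' P) with hQ
    have hQc : IsPreconnected Q := by
      have h1 : IsPreconnected (Subtype.val ⁻¹' P : Set ↥(Sᶜ)) := by
        rw [← Topology.IsInducing.subtypeVal.isPreconnected_image, Set.image_preimage_eq_inter_range,
          Subtype.range_coe, Set.inter_eq_left.2 hPS]
        exact hPc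
      exact h1.image _ ((continuous_subtype_val.comp h.continuous).continuousOn)
    have hQU₀ : Q ⊆ ⋃ s' ∈ S, U s' := by
      rintro _ ⟨x, hx, rfl⟩
      exact hWU (hPW hx)
    -- the component of `⋃ U s'` met by `Q`
    have hx₀ : (⟨p₀, hPS hp₀⟩ : ↥(Sᶜ)) ∈ (Subtype.val ⁻¹' P : Set ↥(Sᶜ)) := hp₀
    obtain ⟨s', hs', hs'U⟩ := Set.mem_iUnion₂.1 (hQU₀ ⟨_, hx₀, rfl⟩)
    set V : Set T := ⋃ s'' ∈ S \ {s'}, U s'' with hV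
    have hVo : IsOpen V := isOpen_biUnion fun s'' _ => (hU s'').2
    have hUV : Disjoint (U s') V := by
      rw [hV, Set.disjoint_iUnion₂_right]
      rintro s'' ⟨hs'', hne⟩
      exact hUd hs' hs'' (fun h' => hne (by rw [mem_singleton_iff, h']))
    have hU₀eq : (⋃ s'' ∈ S, U s'') ⊆ U s' ∪ V := by
      intro y hy
      obtain ⟨s'', hs'', hy⟩ := Set.mem_iUnion₂.1 hy
      by_cases heq : s'' = s'
      · exact Or.inl (heq ▸ hy)
      · exact Or.inr (Set.mem_biUnion ⟨hs'', heq⟩ hy)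
    have hQU : Q ⊆ U s' :=
      hQc.subset_left_of_subset_union (hU s').2 hVo hUV (hQU₀.trans hU₀eq) ⟨_, ⟨_, hx₀, rfl⟩, hs'U⟩
    refine ⟨s', hs', tendsto_nhds.2 fun N hN hs'N => ?_⟩
    -- `h x ∈ (N ∩ U s') ∪ V` eventually, and `h x ∈ Q ⊆ U s'` eventually
    have h1 := eventually_mem_of_homeomorph_compl h hs ((hN.inter (hU s').2).union hVo)
      (fun s'' hs'' => by
        by_cases heq : s'' = s'
        · exact Or.inl ⟨heq ▸ hs'N, heq ▸ (hU s').1⟩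
        · exact Or.inr (Set.mem_biUnion ⟨hs'', heq⟩ (hU s'').1))
    have h2 : ∀ᶠ x : ↥(Sᶜ) in comap Subtype.val (𝓝 s), (x : T) ∈ P := by
      filter_upwards [preimage_mem_comap hPn] with x hx
      exact hx.resolve_left fun h' => x.2 (h' ▸ hs)
    filter_upwards [h1, h2] with x hx1 hx2
    have hxQ : ((h x : ↥(Sᶜ)) : T) ∈ U s' := hQU ⟨x, hx2, rfl⟩
    rcases hx1 with hx1 | hx1
    · exact hx1.1
    · exact absurd hx1 (Set.disjoint_left.1 hUV hxQ)
  choose! lim hlimS hlim using key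
  -- the extension
  refine ⟨fun t => if ht : t ∈ S then lim t else ((h ⟨t, ht⟩ : ↥(Sᶜ)) : T), ?_, fun x => ?_,
    fun s hs => by simp only [dif_pos hs]; exact hlimS s hs⟩
  · rw [continuous_iff_continuousAt]
    intro t
    by_cases ht : t ∈ S
    · -- at a puncture
      rw [ContinuousAt, dif_pos ht]
      refine tendsto_def.2 fun N hN => ?_
      obtain ⟨W, hW, hWN⟩ := mem_comap.1 (tendsto_def.1 (hlim t ht) N hN)
      have hcl : IsClosed (S \ {t}) := (hS.sdiff).isClosed
      filter_upwards [hW, hcl.isOpen_compl.mem_nhds (fun h' => h'.2 rfl)] with y hy hy'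
      by_cases hyS : y ∈ S
      · have : y = t := by
          by_contra hne; exact hy' ⟨hyS, hne⟩
        subst this
        rw [Set.mem_preimage, dif_pos hyS]
        exact mem_of_mem_nhds hN
      · rw [Set.mem_preimage, dif_neg hyS]
        exact hWN (show (⟨y, hyS⟩ : ↥(Sᶜ)) ∈ Subtype.val ⁻¹' W from hy)
    · -- off the punctures the extension is `h`
      have hopen : IsOpen (Sᶜ : Set T) := hS.isClosed.isOpen_compl
      have hcont : ContinuousOn
          (fun t => if ht : t ∈ S then lim t else ((h ⟨t, ht⟩ : ↥(Sᶜ)) : T)) Sᶜ := by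
        rw [continuousOn_iff_continuous_restrict]
        have : (Sᶜ : Set T).restrict
            (fun t => if ht : t ∈ S then lim t else ((h ⟨t, ht⟩ : ↥(Sᶜ)) : T)) =
            fun x : ↥(Sᶜ) => ((h x : ↥(Sᶜ)) : T) := by
          funext x
          simp only [Set.restrict_apply, dif_neg (show ¬ ((x : T) ∈ S) from x.2)]
        rw [this]
        exact continuous_subtype_val.comp h.continuous
      exact hcont.continuousAt (hopen.mem_nhds ht)
  · simp only [dif_neg (show ¬ ((x : T) ∈ S) from x.2)]

end Topological

/-! ### §2 The complex torus: small connected punctured neighbourhoods -/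

section Torus

variable {ι : Type} [Fintype ι] (Φ : (ι → ℝ) ≃L[ℝ] ℂ)

/-- **Points of the complex torus have arbitrarily small connected punctured neighbourhoods missing a
given finite set**: images under the covering map `π : ℂ → ℂ/Φ(ℤ^ι)` (a local homeomorphism) of
small punctured discs, which are path connected. [cite: LangeBirkenhake1992, Lemma 1.1.3 (covering map)] -/
theorem exists_small_punctured_nhd_complexTorus {S : Set (ComplexTorus Φ)} (hS : S.Finite)
    (s : ComplexTorus Φ) (W : Set (ComplexTorus Φ)) (hW : W ∈ 𝓝 s) :
    ∃ P ⊆ W, IsPreconnected P ∧ P.Nonempty ∧ P ⊆ (S \ {s})ᶜ ∧ s ∉ P ∧ insert s P ∈ 𝓝 s := by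
  obtain ⟨z, rfl⟩ := cover_surjective Φ s
  obtain ⟨e, hze, he⟩ := (isCoveringMap_cover (Φ := Φ)).isLocalHomeomorph z
  -- an open disc around `z` inside `e.source`, mapped into `interior W` and off `S ∖ {s}`
  set O : Set ℂ := e.source ∩ cover Φ ⁻¹' interior W ∩ cover Φ ⁻¹' (S \ {cover Φ z})ᶜ with hO
  have hOo : IsOpen O :=
    (e.open_source.inter (isOpen_interior.preimage (continuous_cover Φ))).inter
      ((hS.sdiff).isClosed.isOpen_compl.preimage (continuous_cover Φ))
  have hzO : z ∈ O := ⟨⟨hze, mem_interior_iff_mem_nhds.2 hW⟩, fun h => h.2 rfl⟩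
  obtain ⟨r, hr, hrO⟩ := Metric.isOpen_iff.1 hOo z hzO
  refine ⟨cover Φ '' (Metric.ball z r \ {z}), ?_, ?_, ?_, ?_, ?_, ?_⟩
  · rintro _ ⟨w, hw, rfl⟩
    exact interior_subset (hrO hw.1).1.2
  · refine (IsPathConnected.image ?_ (continuous_cover Φ)).isConnected.isPreconnected
    refine isPathConnected_convex_diff_finite (convex_ball z r) Metric.isOpen_ball
      (Set.finite_singleton z) ⟨z + (r / 2 : ℝ), ?_, ?_⟩
    · rw [Metric.mem_ball, dist_self_add_left, Complex.norm_real, Real.norm_eq_abs,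
        abs_of_pos (half_pos hr)]
      exact half_lt_self hr
    · intro h
      have : ((r / 2 : ℝ) : ℂ) = 0 := by simpa using h
      exact (half_pos hr).ne' (by exact_mod_cast this)
  · refine ⟨cover Φ (z + (r / 2 : ℝ)), z + (r / 2 : ℝ), ⟨?_, ?_⟩, rfl⟩
    · rw [Metric.mem_ball, dist_self_add_left, Complex.norm_real, Real.norm_eq_abs,
        abs_of_pos (half_pos hr)]
      exact half_lt_self hr
    · intro h
      have : ((r / 2 : ℝ) : ℂ) = 0 := by simpa using h
      exact (half_pos hr).ne' (by exact_mod_cast this)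
  · rintro _ ⟨w, hw, rfl⟩
    exact (hrO hw.1).2
  · rintro ⟨w, hw, hwz⟩
    apply hw.2
    have h1 : e w = e z := by rw [← he]; exact hwz
    exact e.injOn (hrO hw.1).1.1 hze h1
  · have himg : cover Φ '' Metric.ball z r ⊆ insert (cover Φ z) (cover Φ '' (Metric.ball z r \ {z})) := by
      rintro _ ⟨w, hw, rfl⟩
      by_cases hwz : w = z
      · exact Or.inl (by rw [hwz])
      · exact Or.inr ⟨w, ⟨hw, hwz⟩, rfl⟩
    refine Filter.mem_of_superset ?_ himg
    exact ((isCoveringMap_cover (Φ := Φ)).isLocalHomeomorph.isOpenMap _ Metric.isOpen_ball).mem_nhds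
      ⟨z, Metric.mem_ball_self hr, rfl⟩

/-- The hypothesis of `exists_continuous_extension_of_homeomorph_compl_finite` for the complex torus.
[cite: LangeBirkenhake1992, Lemma 1.1.3 (covering map)] -/
theorem exists_small_punctured_nhd_complexTorus' {S : Set (ComplexTorus Φ)} (hS : S.Finite) :
    ∀ s ∈ S, ∀ W ∈ 𝓝 s, ∃ P ⊆ W, IsPreconnected P ∧ P.Nonempty ∧ P ⊆ Sᶜ ∧ insert s P ∈ 𝓝 s := by
  intro s _ W hW
  obtain ⟨P, hPW, hPc, hPn, hPS, hsP, hP⟩ := exists_small_punctured_nhd_complexTorus Φ hS s W hW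
  refine ⟨P, hPW, hPc, hPn, fun p hp hpS => ?_, hP⟩
  by_cases hps : p = s
  · exact hsP (hps ▸ hp)
  · exact hPS hp ⟨hpS, hps⟩

/-! ### §3 Automorphisms of `ℂ/Φ(ℤ²) ∖ S` are restrictions of affine maps -/

/-- ★ **Every automorphism (in `HolRS`) of the curve `ℂ/Φ(ℤ^ι) ∖ S` is the restriction of a holomorphic
AFFINE self-map of the torus preserving `S`**: for `σ : X ≅ X`, `X = ofOpens ⟨Sᶜ, _⟩` (`S` finite,
non-empty), there is `H : E → E` continuous and holomorphic with `H ∘ ι = ι ∘ σ`, `H(S) ⊆ S`, and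
`H = ρ(ρ_H) + H 0` (continuous extension `exists_continuous_extension_of_homeomorph_compl_finite`;
holomorphic off `S`, hence at `S` by the removable singularity theorem
`RiemannSurface.mdifferentiableAt_of_continuousAt`; affine by Lange–Birkenhake Prop. 1.1.6, the tree's
`eq_mapMatrix_topRep_add_of_mdifferentiable`). [cite: LangeBirkenhake1992, Proposition 1.1.6]
[cite: MochizukiAbsTopIII2015, Lemma 4.3 p.106] -/
theorem exists_affine_extension_of_iso_compl_finite [DecidableEq ι] {S : Set (ComplexTorus Φ)}
    (hS : S.Finite)
    (hconn : IsConnected (((⟨Sᶜ, hS.isClosed.isOpen_compl⟩ : Opens (ComplexTorus Φ)) :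
      Set (ComplexTorus Φ))))
    (σ : ofOpens (M := ComplexTorus Φ) ⟨Sᶜ, hS.isClosed.isOpen_compl⟩ hconn ≅
      ofOpens (M := ComplexTorus Φ) ⟨Sᶜ, hS.isClosed.isOpen_compl⟩ hconn) :
    ∃ H : ComplexTorus Φ → ComplexTorus Φ, ∃ hH : Continuous H,
      MDifferentiable 𝓘(ℂ, ℂ) 𝓘(ℂ, ℂ) H ∧
      (∀ x : (ofOpens (M := ComplexTorus Φ) ⟨Sᶜ, hS.isClosed.isOpen_compl⟩ hconn).carrier,
        H x.1 = (σ.hom.toFun x).1) ∧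
      (∀ s ∈ S, H s ∈ S) ∧
      ∀ y, H y = mapMatrix Φ Φ (topRep (Φ₁ := Φ) (Φ := Φ) hH) y + H 0 := by
  -- the homeomorphism underlying `σ`
  let h : (ofOpens (M := ComplexTorus Φ) ⟨Sᶜ, hS.isClosed.isOpen_compl⟩ hconn).carrier ≃ₜ
      (ofOpens (M := ComplexTorus Φ) ⟨Sᶜ, hS.isClosed.isOpen_compl⟩ hconn).carrier :=
    { toFun := σ.hom.toFun
      invFun := σ.inv.toFun
      left_inv := fun y => congrFun (congrArg Hom.toFun σ.hom_inv_id) y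
      right_inv := fun y => congrFun (congrArg Hom.toFun σ.inv_hom_id) y
      continuous_toFun := σ.hom.mdifferentiable.continuous
      continuous_invFun := σ.inv.mdifferentiable.continuous }
  obtain ⟨H, hHc, hHh, hHS⟩ := exists_continuous_extension_of_homeomorph_compl_finite
    (T := ComplexTorus Φ) (S := S) hS (exists_small_punctured_nhd_complexTorus' Φ hS) h
  have hHd : MDifferentiable 𝓘(ℂ, ℂ) 𝓘(ℂ, ℂ) H := by
    -- off `S`: `H` is `σ` read in the torus
    have hoff : ∀ x : (⟨Sᶜ, hS.isClosed.isOpen_compl⟩ : Opens (ComplexTorus Φ)),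
        MDifferentiableAt 𝓘(ℂ, ℂ) 𝓘(ℂ, ℂ) H x.1 := by
      intro x
      have h1 := (mdifferentiableAt_subtypeVal_comp_iff
        (⟨Sᶜ, hS.isClosed.isOpen_compl⟩ : Opens (ComplexTorus Φ)) σ.hom.toFun x).2
        (σ.hom.mdifferentiable x)
      have h2 : (Subtype.val ∘ σ.hom.toFun) =
          fun y : (⟨Sᶜ, hS.isClosed.isOpen_compl⟩ : Opens (ComplexTorus Φ)) => H y.1 :=
        funext fun y => (hHh y).symm
      rw [h2] at h1
      exact (mdifferentiableAt_subtype_iff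
        (U := (⟨Sᶜ, hS.isClosed.isOpen_compl⟩ : Opens (ComplexTorus Φ))) (f := H) (x := x)).1 h1
    intro t
    by_cases ht : t ∈ S
    · refine RiemannSurface.mdifferentiableAt_of_continuousAt hHc.continuousAt ?_
      have hcl : IsClosed (S \ {t}) := (hS.sdiff).isClosed
      have hmem : (S \ {t})ᶜ ∈ 𝓝[≠] t :=
        mem_nhdsWithin_of_mem_nhds (hcl.isOpen_compl.mem_nhds fun h' => h'.2 rfl)
      filter_upwards [hmem, self_mem_nhdsWithin] with y hy hyt
      have hyS : y ∉ S := fun h' => hy ⟨h', hyt⟩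
      exact hoff ⟨y, hyS⟩
    · exact hoff ⟨t, ht⟩
  exact ⟨H, hHc, hHd, fun x => hHh x, hHS,
    fun y => eq_mapMatrix_topRep_add_of_mdifferentiable (Φ₁ := Φ) (Φ := Φ) hHd y⟩

end Torus

end HolRS

end Literature.AnabelianGeometry.AbsoluteAnabelian

end
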